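import Summits.CriticalPhenomena.PercolationContinuityZ3.Theorems.PercNearOneGluingNoHeavyPcintMemAutomatonPolygons
import Summits.CriticalPhenomena.PercolationContinuityZ3.Theorems.PercNearOneGluingNoHeavyPcintMemoryTailGrowth
import HarnessLib

/-!
# CriticalPhenomena/PercolationContinuityZ3 — Theorems/PercNearOneGluingNoHeavyPcintMemAutomatonStates.lean: the state space of the memory automaton is the set of dangerous sets of `(τ−1)`-step SAWs

Lane prim-pcint, STRUCTURE rule, law C3 (class-count / cost law; P8, gen13/README §3).  The dangerous set of a memory-`τ` word
depends only on its last `τ − 1` letters (`danger_eq_danger_suffix`), and those letters form a self-avoiding word; hence for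
every length `n ≥ τ − 1` the states reached after `n` letters are among the states reached after exactly `τ − 1` letters
(`image_danger_subset`), whose number is at most `c_{τ−1}(ℤ^d)` (`card_image_danger_le_count`).  Together with
`…PcintMemAutomatonPolygons` this is the rigorous SANDWICH of C3 for the recurrent state space:
`2τ·p_τ ≤ #{dangerous sets of (τ−1)-step SAWs} ≤ c_{τ−1}`, i.e. `μ^τ τ^{α−2} ≲ N ≲ μ^τ τ^{γ−1}` in exponent form; the law says the
floor is the truth (`N ≍ μ^τ τ^{−dν}`).  All PROVED; nothing here is used by a certified `p_c` cell.
Written by prim-pcint-2 gen 13 (prover-prim-pcint-2-g13-0), 2026-08-23.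
-/

noncomputable section

open Literature.Probability.LatticeModels Literature.Probability.Percolation
open Literature.Probability.RandomPlanarGeometry.SAW.Zd (count)
open Summit.CriticalPhenomena.PercolationContinuityZ3.Theorems.Pcint (IsMem l1 danger mem_danger)

namespace Summit.CriticalPhenomena.PercolationContinuityZ3.Theorems.Pcint.MemoryTail

variable {d : ℕ}

/-- **The dangerous set sees only the last `τ − 1` letters**: for a word of length `N + (τ − 1)`, `danger τ w` equals the
dangerous set of its suffix of length `τ − 1` (positions relative to the tip agree, `wordPos_suffix`). [folklore] -/
theorem danger_eq_danger_suffix (τ N : ℕ) (w : Fin (N + (τ - 1)) → Fin d × Bool) :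
    danger τ w = danger τ (fun i : Fin (τ - 1) => w (Fin.natAdd N i)) := by
  ext ⟨r, j⟩
  rw [mem_danger, mem_danger]
  constructor
  · rintro ⟨h1, h2, h3, hr, hl⟩
    refine ⟨h1, h2, h2, ?_, hl⟩
    rw [hr, wordPos_suffix w (τ - 1 - j) (by omega), wordPos_suffix w (τ - 1) le_rfl,
      show N + (τ - 1 - j) = N + (τ - 1) - j by omega]
    abel
  · rintro ⟨h1, h2, -, hr, hl⟩
    refine ⟨h1, h2, by omega, ?_, hl⟩
    rw [hr, wordPos_suffix w (τ - 1 - j) (by omega), wordPos_suffix w (τ - 1) le_rfl,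
      show N + (τ - 1 - j) = N + (τ - 1) - j by omega]
    abel

/-- **States after `n ≥ τ − 1` letters ⊆ states after `τ − 1` letters**: the dangerous sets of memory-`τ` words of length
`N + (τ − 1)` are dangerous sets of memory-`τ` (indeed self-avoiding) words of length `τ − 1`. [folklore] -/
theorem image_danger_subset (d τ N : ℕ) :
    (memWords d τ (N + (τ - 1))).image (danger τ) ⊆ (memWords d τ (τ - 1)).image (danger τ) := by
  classical
  intro S hS
  rw [Finset.mem_image] at hS ⊢
  obtain ⟨w, hw, rfl⟩ := hS
  refine ⟨fun i : Fin (τ - 1) => w (Fin.natAdd N i), ?_, (danger_eq_danger_suffix τ N w).symm⟩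
  rw [mem_memWords] at hw ⊢
  exact isMem_suffix hw

/-- **At most `c_{τ−1}` recurrent states** (`d ≥ 1`): the dangerous sets reached after `τ − 1` letters number at most the
`(τ−1)`-step self-avoiding walks. [folklore] -/
theorem card_image_danger_le_count (d τ : ℕ) [NeZero d] :
    ((memWords d τ (τ - 1)).image (danger τ)).card ≤ count d (τ - 1) := by
  classical
  calc ((memWords d τ (τ - 1)).image (danger τ)).card ≤ (memWords d τ (τ - 1)).card := Finset.card_image_le
    _ = count d (τ - 1) := memCount_eq_count (by omega)

/-- The sandwich in one line (`d ≥ 1`): closing `(τ−1)`-step SAWs ≤ recurrent states ≤ all `(τ−1)`-step SAWs. [folklore] -/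
theorem closing_le_states_le_count (d τ : ℕ) [NeZero d] :
    ((sawWords d (τ - 1)).filter fun w => l1 (wordPos w (τ - 1)) ≤ 1).card ≤ ((memWords d τ (τ - 1)).image (danger τ)).card ∧
      ((memWords d τ (τ - 1)).image (danger τ)).card ≤ count d (τ - 1) :=
  ⟨card_closing_le_card_image_danger d τ, card_image_danger_le_count d τ⟩

end Summit.CriticalPhenomena.PercolationContinuityZ3.Theorems.Pcint.MemoryTail
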